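import Summits.HodgeConjecture.HodgeConjecture.Theorems.CYFormCasimirCYFormSquarePrincipleInvariantForms
import Summits.HodgeConjecture.HodgeConjecture.Theorems.CYFormCasimirCYFormSquarePrincipleCup
import HarnessLib

/-!
# Crux X1 `CYFormCarrierEight` (route `CYFormCasimir`, stmt-HodgeConjecture-23493), helper file 8:
# the pairing `β(x, y) = tr(x ∪ y ∪ h_K⁴)` between `⋀⁴W` and `⋀⁴W^*` — `SU_H`-invariance and off-diagonal vanishing

research route conditional on HC_CM; not a corollary. Nothing here proves HC, HC_CM, the rung H2, X1 or `stub_cyform_exists`;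
step S1 (first half) of `Cruxes/CYFormCarrierEight/STUB-PLAN-stub_cyform_exists.md`: the duality pairing through which the
Hodge star `s₊ : ⋀⁴W → ⋀⁴W^*` is to be defined.

For a Hodge-general (`HasHodgeGroupSU`) `ℚ(√-d)`-Weil eightfold `(A, φ)` with `K`-symmetrised class `h_K` and Weil frame
`bW = (w, w^*)` (`VanGeemen1994.bW`), and `β(x, y) := tr((x ∪ y) ∪ h_K⁴)` (`tr = topCoord`, the coordinate on the top line):
* `beta_extAct_eq` — `β(⋀⁴u·x, ⋀⁴u·y) = β(x, y)` for every `u ∈ SU_H(ℂ)` (`u = g₁` for a Hodge-group element `g`, which is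
  multiplicative, fixes the Hodge class `h_K⁴` and acts trivially on `H¹⁶`);
* `torusWeight_map_castAddEmb`, `exists_torusWeight_castAdd_mul_natAdd_ne_one` — torus weights of `w`-monomials, and a
  torus element of `SU_H(ℂ)` with weight product `≠ 1` on a pair `(w_I, w^*_K)`, `I ≠ K`;
* `beta_monB_eq_zero_of_ne` — hence **`β(w_I, w^*_K) = 0` for `I ≠ K`**: in the Weil frame `β` is DIAGONAL between the
  monomial bases of `⋀⁴W` and `⋀⁴W^*` (the non-vanishing and `I`-independence of the diagonal — via the expansion
  `h_K⁴ = 24 α_K⁴ Σ_J w_J w^*_J` — is the second half of S1, not done here).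

References: vanGeemen1994HodgeAV (Lemma 6.10, Thm. 6.12 and its proof), FriedmanLaza2013 (§3.5 Lemma 36).
-/

-- `Summit.HodgeConjecture.HodgeConjecture.…` is the tree's mandated summit/problem namespace (single-problem summit).
set_option linter.dupNamespace false
noncomputable section

open CategoryTheory
open Literature.AlgebraicTopology.SingularHomology
open Literature.AlgebraicGeometry.Motives
open Literature.AlgebraicGeometry.HodgeTheory
open Literature.AlgebraicGeometry.VanGeemen1994

namespace Summit.HodgeConjecture.HodgeConjecture.Theorems.CYFormCarrier

/-! ## §1 Torus weights of `w`-monomials and of mixed pairs -/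

section Combinatorics

variable {k : ℕ}

/-- The torus weights: `2` at `i₀`, `2⁻¹` at `i₁`, `1` elsewhere (`i₀ ≠ i₁`). [cite: vanGeemen1994HodgeAV, proof of Thm. 6.12] -/
theorem coe_torusWt (i₀ i₁ : Fin k) (hne : i₀ ≠ i₁) (j : Fin k) :
    ((torusWt i₀ i₁ j : ℂˣ) : ℂ) = if j = i₀ then 2 else if j = i₁ then 2⁻¹ else 1 := by
  have h := CYFormSquare.coe_torusWt_inv i₀ i₁ hne j
  rw [Units.val_inv_eq_inv_val] at h
  have h' : ((torusWt i₀ i₁ j : ℂˣ) : ℂ) = (if j = i₀ then (2 : ℂ)⁻¹ else if j = i₁ then 2 else 1)⁻¹ := by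
    rw [← h, inv_inv]
  rw [h']
  split_ifs <;> norm_num

/-- The torus unit on a first-block index is the weight (the tree's lemma is private). [folklore] -/
theorem torusUnits_castAdd' (i₀ i₁ i : Fin k) : torusUnits i₀ i₁ (Fin.castAdd k i) = torusWt i₀ i₁ i := by
  rw [torusUnits, Fin.append_left]

/-- **Torus weight of a `w`-monomial**: `2^{[i₀ ∈ I]} · 2^{-[i₁ ∈ I]}`. [cite: vanGeemen1994HodgeAV, proof of Thm. 6.12] -/
theorem torusWeight_map_castAddEmb {q : ℕ} (i₀ i₁ : Fin k) (hne : i₀ ≠ i₁) (I : Set.powersetCard (Fin k) q) :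
    torusWeight i₀ i₁ (Set.powersetCard.map q (Fin.castAddEmb k) I).val =
      (if i₀ ∈ I.val then (2 : ℂ) else 1) * (if i₁ ∈ I.val then (2 : ℂ)⁻¹ else 1) := by
  classical
  rw [torusWeight, Set.powersetCard.val_map, Finset.prod_map]
  have h : ∀ j ∈ I.val, ((torusUnits i₀ i₁ (Fin.castAddEmb k j) : ℂˣ) : ℂ) =
      (if j = i₀ then (2 : ℂ) else 1) * (if j = i₁ then (2 : ℂ)⁻¹ else 1) := by
    intro j _
    change ((torusUnits i₀ i₁ (Fin.castAdd k j) : ℂˣ) : ℂ) = _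
    rw [torusUnits_castAdd', coe_torusWt i₀ i₁ hne]
    by_cases h0 : j = i₀
    · subst h0; rw [if_pos rfl, if_pos rfl, if_neg hne, mul_one]
    · rw [if_neg h0, if_neg h0, one_mul]
  rw [Finset.prod_congr rfl h, Finset.prod_mul_distrib, Finset.prod_ite_eq', Finset.prod_ite_eq']

/-- **Torus weights separate the mixed pairs `(w_I, w^*_K)`, `I ≠ K`**: for `i₀ ∈ I ∖ K`, `i₁ ∈ K ∖ I` the weights are
`2` and `2`, product `4 ≠ 1`. [cite: vanGeemen1994HodgeAV, proof of Thm. 6.12] -/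
theorem exists_torusWeight_castAdd_mul_natAdd_ne_one {q : ℕ} (I K : Set.powersetCard (Fin k) q) (hIK : I ≠ K) :
    ∃ i₀ i₁ : Fin k, i₀ ≠ i₁ ∧
      torusWeight i₀ i₁ (Set.powersetCard.map q (Fin.castAddEmb k) I).val *
        torusWeight i₀ i₁ (Set.powersetCard.map q (Fin.natAddEmb k) K).val ≠ 1 := by
  classical
  obtain ⟨i₀, hi₀I, hi₀K⟩ := (Set.powersetCard.exists_mem_notMem_iff_ne I K).1 hIK
  obtain ⟨i₁, hi₁K, hi₁I⟩ := (Set.powersetCard.exists_mem_notMem_iff_ne K I).1 (Ne.symm hIK)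
  have hne : i₀ ≠ i₁ := fun h ↦ hi₀K (h ▸ hi₁K)
  refine ⟨i₀, i₁, hne, ?_⟩
  rw [torusWeight_map_castAddEmb i₀ i₁ hne I, CYFormSquare.torusWeight_map_natAddEmb i₀ i₁ hne K,
    if_pos (Set.powersetCard.mem_coe_iff.2 hi₀I), if_neg (fun h ↦ hi₁I (Set.powersetCard.mem_coe_iff.1 h)),
    if_neg (fun h ↦ hi₀K (Set.powersetCard.mem_coe_iff.1 h)), if_pos (Set.powersetCard.mem_coe_iff.2 hi₁K)]
  norm_num

end Combinatorics

/-! ## §2 The pairing `β(x, y) = tr((x ∪ y) ∪ h_K⁴)`: invariance and off-diagonal vanishing -/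

section Beta

variable {A : AbelianVariety ℂ} {d : ℕ} {φ : A ⟶ A}
variable (hn : 2 ≤ 4) (hd : 0 < d) (hA : A.dim = 2 * 4) (hφ : φ ≫ φ = -(d • 𝟙 A))
  (e : ProjectiveEmbedding A.X) {a : complexBetti (projectiveSpace e.n ℂ) 2} (ha : IsRationalClass a)
  (ha0 : a ≠ 0)

/-- `dim A = 7 + 1` (the indexing of `topCoord`). [folklore] -/
theorem dim_eq_seven_add_one (hA : A.dim = 2 * 4) : A.dim = 7 + 1 := by rw [hA]

include hn hd hφ ha ha0 in
/-- **`β` is `SU_H(ℂ)`-invariant**: `tr((⋀⁴u x ∪ ⋀⁴u y) ∪ h_K⁴) = tr((x ∪ y) ∪ h_K⁴)` for `u ∈ SU_H(ℂ)` when `Hg = SU_H`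
(`u = g₁` for a Hodge-group element `g`, which is multiplicative on `H^*(A(ℂ); ℂ)`, fixes the Hodge class `h_K⁴`, and acts
trivially on `H¹⁶`). [cite: vanGeemen1994HodgeAV, 6.5–6.7 and Thm. 6.12] -/
theorem beta_extAct_eq (hSU : HasHodgeGroupSU A φ 4 d (hK d φ e a))
    {u : complexBetti A.X 1 ≃ₗ[ℂ] complexBetti A.X 1} (hu : u ∈ weilSpecialUnitaryGroup A φ 4 d (hK d φ e a))
    (x y : complexBetti A.X (2 * 2)) :
    topCoord (dim_eq_seven_add_one hA)
        (cupProduct (show 2 * 4 + 2 * 4 = 2 + 2 * 7 from rfl)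
          (cupProduct (show 2 * 2 + 2 * 2 = 2 * 4 from rfl)
            (extAct (u : complexBetti A.X 1 →ₗ[ℂ] complexBetti A.X 1) (2 * 2) x)
            (extAct (u : complexBetti A.X 1 →ₗ[ℂ] complexBetti A.X 1) (2 * 2) y))
          (cupPowTwo (hK d φ e a) 4)) =
      topCoord (dim_eq_seven_add_one hA)
        (cupProduct (show 2 * 4 + 2 * 4 = 2 + 2 * 7 from rfl)
          (cupProduct (show 2 * 2 + 2 * 2 = 2 * 4 from rfl) x y) (cupPowTwo (hK d φ e a) 4)) := by
  have hu' : u ∈ hodgeGroupOne A.dim A.X := by rw [hSU]; exact hu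
  obtain ⟨g, hg, rfl⟩ := mem_hodgeGroupOne_iff.1 hu'
  have h4 : g (2 * 4) (cupPowTwo (hK d φ e a) 4) = cupPowTwo (hK d φ e a) 4 :=
    apply_eq_self_of_mem_hodgeClassSpan hg (cupPowTwo_hK_mem_hodgeClassSpan hn hd hA e ha ha0 4)
  rw [← hodgeGroup_apply_eq_extAct hg, ← hodgeGroup_apply_eq_extAct hg, ← hodgeGroup_map_cupProduct hg]
  conv_lhs => rw [← h4, ← hodgeGroup_map_cupProduct hg, hodgeGroup_apply_eq_extAct hg]
  exact congrArg _ (CYFormSquare.extAct_top_eq_self hn hd hA hφ e ha ha0 hSU hu _)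

include hn hd hA hφ e ha ha0 in
/-- **`β(w_I, w^*_K) = 0` for `I ≠ K`**: in the Weil frame the pairing `β(x, y) = tr((x ∪ y) ∪ h_K⁴)` between the monomial
bases `{w_I}` of `⋀⁴W` and `{w^*_K}` of `⋀⁴W^*` is DIAGONAL (a torus element of `SU_H(ℂ)` with weight product `4` on the pair,
and invariance). [cite: vanGeemen1994HodgeAV, proof of Thm. 6.12] [cite: FriedmanLaza2013, §3.5 Lemma 36] -/
theorem beta_monB_eq_zero_of_ne (hSU : HasHodgeGroupSU A φ 4 d (hK d φ e a))
    (I K : Set.powersetCard (Fin (2 * 4)) (2 * 2)) (hIK : I ≠ K) :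
    topCoord (dim_eq_seven_add_one hA)
        (cupProduct (show 2 * 4 + 2 * 4 = 2 + 2 * 7 from rfl)
          (cupProduct (show 2 * 2 + 2 * 2 = 2 * 4 from rfl)
            (monB (bW hn hd hA hφ e ha ha0) (2 * 2) (Set.powersetCard.map (2 * 2) (Fin.castAddEmb (2 * 4)) I))
            (monB (bW hn hd hA hφ e ha ha0) (2 * 2) (Set.powersetCard.map (2 * 2) (Fin.natAddEmb (2 * 4)) K)))
          (cupPowTwo (hK d φ e a) 4)) = 0 := by
  obtain ⟨i₀, i₁, hne, hw⟩ := exists_torusWeight_castAdd_mul_natAdd_ne_one I K hIK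
  set u := torusAuto (m := 2 * 4 - 1) (k := 2 * 4) (by omega) (by omega) hd hφ e ha ha0 (wBasis hd hφ hA) i₀ i₁ with hudef
  have hu : u ∈ weilSpecialUnitaryGroup A φ 4 d (hK d φ e a) :=
    torusAuto_mem (m := 2 * 4 - 1) (by omega) (by omega) hd hφ e ha ha0 (wBasis hd hφ hA) 4 d (by omega) rfl hne
  have hinv := beta_extAct_eq hn hd hA hφ e ha ha0 hSU hu
    (monB (bW hn hd hA hφ e ha ha0) (2 * 2) (Set.powersetCard.map (2 * 2) (Fin.castAddEmb (2 * 4)) I))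
    (monB (bW hn hd hA hφ e ha ha0) (2 * 2) (Set.powersetCard.map (2 * 2) (Fin.natAddEmb (2 * 4)) K))
  have h1 : extAct (u : complexBetti A.X 1 →ₗ[ℂ] complexBetti A.X 1) (2 * 2)
      (monB (bW hn hd hA hφ e ha ha0) (2 * 2) (Set.powersetCard.map (2 * 2) (Fin.castAddEmb (2 * 4)) I)) =
      torusWeight i₀ i₁ (Set.powersetCard.map (2 * 2) (Fin.castAddEmb (2 * 4)) I).val •
        monB (bW hn hd hA hφ e ha ha0) (2 * 2) (Set.powersetCard.map (2 * 2) (Fin.castAddEmb (2 * 4)) I) :=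
    extAct_torusAuto_monB (m := 2 * 4 - 1) (by omega) (by omega) hd hφ e ha ha0 (wBasis hd hφ hA) i₀ i₁ (2 * 2) _
  have h2 : extAct (u : complexBetti A.X 1 →ₗ[ℂ] complexBetti A.X 1) (2 * 2)
      (monB (bW hn hd hA hφ e ha ha0) (2 * 2) (Set.powersetCard.map (2 * 2) (Fin.natAddEmb (2 * 4)) K)) =
      torusWeight i₀ i₁ (Set.powersetCard.map (2 * 2) (Fin.natAddEmb (2 * 4)) K).val •
        monB (bW hn hd hA hφ e ha ha0) (2 * 2) (Set.powersetCard.map (2 * 2) (Fin.natAddEmb (2 * 4)) K) :=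
    extAct_torusAuto_monB (m := 2 * 4 - 1) (by omega) (by omega) hd hφ e ha ha0 (wBasis hd hφ hA) i₀ i₁ (2 * 2) _
  rw [h1, h2] at hinv
  simp only [map_smul, LinearMap.smul_apply, smul_eq_mul] at hinv
  set B := topCoord (dim_eq_seven_add_one hA)
        (cupProduct (show 2 * 4 + 2 * 4 = 2 + 2 * 7 from rfl)
          (cupProduct (show 2 * 2 + 2 * 2 = 2 * 4 from rfl)
            (monB (bW hn hd hA hφ e ha ha0) (2 * 2) (Set.powersetCard.map (2 * 2) (Fin.castAddEmb (2 * 4)) I))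
            (monB (bW hn hd hA hφ e ha ha0) (2 * 2) (Set.powersetCard.map (2 * 2) (Fin.natAddEmb (2 * 4)) K)))
          (cupPowTwo (hK d φ e a) 4)) with hB
  have h' : (torusWeight i₀ i₁ (Set.powersetCard.map (2 * 2) (Fin.castAddEmb (2 * 4)) I).val *
      torusWeight i₀ i₁ (Set.powersetCard.map (2 * 2) (Fin.natAddEmb (2 * 4)) K).val - 1) * B = 0 := by
    linear_combination hinv
  exact (mul_eq_zero.1 h').resolve_left (sub_ne_zero.2 hw)

end Beta

end Summit.HodgeConjecture.HodgeConjecture.Theorems.CYFormCarrier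

end
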